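/-
Copyright (c) 2026 the pub-hodgecm-mathlib formalisation cell (harness21).  Prover seat hodgecm-mathlib-K2E3-p14 (g4) (free E3 hand on the E1 campaign
«EIS-RANK-ONE», deal (D2-d) of K2E1-plan (g3) 2026-09-04T06:03:59Z), h413 = `stmt-HodgeConjecture-24833`, rung R6d₃: THE LATTICE COUNT OF THE CENTRE-LINE LAYER —
for the archimedean-decay ∕ finite-compact class `|Ψ(x)| ≤ M(1+‖x_∞‖)^{-k}𝟙_{C_f}(x_f)` (`k > [K:ℚ]`), `Σ_{ξ ∈ K} |Ψ(λ(ξ − Y))| ≤ B·|λ|⁻¹` for EVERY idele `|λ| ≤ 1` and EVERY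
shift `Y` (number-field generic).  2026-09-04.
-/
import Summits.HodgeConjecture.HodgeConjecture.Theorems.K2E1AdelicFourierDecay   -- ★ p857643 (K2E4-p10 (g3)): the (E2) decay class (its binder letters are reused here)
import Literature.NumberTheory.Automorphic.AdelicLatticeEscapeBoxCount    -- ★ `exists_ncard_mul_algebraMap_add_mem_le` (box count, uniform in the shift)
import Literature.NumberTheory.Automorphic.AdelicRationalVectorCount      -- ★ `isCompact_setOf_norm_le_one_and_mem`, `posRealIdele_fst/snd`, `ringEquiv_mixedSpace_realToInfiniteAdele`
import Mathlib.Analysis.SpecialFunctions.Pow.Real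
import HarnessLib

/-!
# h413 ∕ Track B «K2-LIT», «EIS-RANK-ONE» R6d₃ (D2-d) — helper `K2E1CentreLineLatticeCountU3`:
# the `E`-lattice count inside the centre-line decay binder `hdecF` (number-field generic)

Cell `pub/hodgecm-mathlib`, crux H413 = `stmt-HodgeConjecture-24833`, route `HCCMUnconditional`; DEAL (D2-d) of the dealer K2E1-plan (g3) 2026-09-04T06:03:59Z ∕ 06:05:19Z
(the `Σ'_{x₀ ∈ E}` count inside the binder `hdecF` of ★ p857799 `K2E1EisensteinMinusConstantTermCuspBoundU3`).  THEOREMS ONLY (no `def`, no `instance`, no `notation`,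
no named-fact hypothesis, no `sorry`); lane `--kind proof --supports stmt-HodgeConjecture-24833 --as helper` (count-neutral).

THE ESTIMATE (Weil's Riemann-sum count; Gelbart (1975) proof of Lemma 9.13; Rogawski (1990) §7.2 p. 95).  Let `K` be a number field, `d = [K:ℚ]`, `‖x_∞‖` the sup norm of
the archimedean component in `K ⊗ ℝ` (`InfiniteAdeleRing.ringEquiv_mixedSpace`), and `Ψ : 𝔸_K → ℂ` in the DECAY CLASS of ★ p857643 (E2): `|Ψ(x)| ≤ M(1+‖x_∞‖)^{-k}`,
`Ψ(x) = 0` unless `x_f ∈ C_f` (`C_f ⊆ 𝔸_K^∞` compact), with `d < k`.  Then there is ONE `B ≥ 0` (depending on `M, k, C_f` only) with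
`Σ_{ξ ∈ K} |Ψ(λ(ξ − Y))| ≤ B · |λ|_𝔸⁻¹` for every idele `λ` with `|λ| ≤ 1` and EVERY adele `Y` (**`exists_forall_tsum_norm_dilate_sub_le`**; summability included).
PROOF: dyadic shells in the archimedean norm.  `(1+t)^{-k} ≤ 2^k·2^{-(m+1)k}` on `{t ≤ 2^{m+1}}` for the least such `m` (§2), so `|Ψ| ≤ Σ_j M2^k2^{-(j+1)k}𝟙_{C_j}`,
`C_j = {‖x_∞‖ ≤ 2^{j+1}, x_f ∈ C_f} = z(2^{j+1})·C₀` with `z(r)` the positive-real idele (§1: `‖(z(r)x)_∞‖ = r‖x_∞‖`, `(z(r)x)_f = x_f`); the ★ BOX COUNT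
`#{ξ : aξ + s ∈ C₀} ≤ c₁·max(1, |a|⁻¹)` (uniform in `s`!) at `a = z(2^{-(j+1)})λ`, `|a| = 2^{-(j+1)d}|λ|`, gives `#{ξ : λ(ξ − Y) ∈ C_j} ≤ c₁2^{(j+1)d}|λ|⁻¹` (§3), and
`Σ_j 2^{-(j+1)(k−d)} < ∞` (§4, Tonelli in `ℝ≥0∞`).  No reduction modulo `K^×`, no Peetre shift: the box count is already uniform in the shift.

HONEST LABEL.  Count-neutral helper; proves no printed statement; HC_CM is proved only modulo the 7 printed citations (2 remaining named inputs: hLiu418 =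
`stmt-HodgeConjecture-24832`, h413 = `stmt-HodgeConjecture-24833`) until rung 0 closes.

## References
* [Gelbart1975] S. Gelbart, *Automorphic forms on adele groups* (1975), proof of Lemma 9.13.
* [Rogawski1990] J. Rogawski, *Automorphic Representations of Unitary Groups in Three Variables* (1990), §7.2 (p. 95).
* [CasselsFrohlichANT1967] J. W. S. Cassels, A. Fröhlich (eds.), *Algebraic Number Theory* (1967), Ch. II §14 (lattice points in adelic boxes).
-/

set_option autoImplicit false
set_option linter.dupNamespace false  -- the mandated namespace repeats the summit's segment (`HodgeConjecture.HodgeConjecture`)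

noncomputable section

open scoped NNReal ENNReal Pointwise Classical
open NumberField NumberField.mixedEmbedding IsDedekindDomain Set MeasureTheory Module
open Literature.NumberTheory.Automorphic Literature.NumberTheory.GaloisRepresentations

namespace Summit.HodgeConjecture.HodgeConjecture.Cruxes.H413.K2E1CentreLineLatticeCountU3

variable (K : Type) [Field K] [NumberField K]

/-! ## §1 Positive-real ideles on the two components -/

/-- `‖(z(r)·x)_∞‖ = r·‖x_∞‖`. [folklore] -/
theorem norm_fst_posRealIdele_mul (r : ℝ≥0ˣ) (x : AdeleRing (𝓞 K) K) :
    ‖InfiniteAdeleRing.ringEquiv_mixedSpace K (((posRealIdele K r : (AdeleRing (𝓞 K) K)ˣ) : AdeleRing (𝓞 K) K) * x).1‖ =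
      ((r : ℝ≥0) : ℝ) * ‖InfiniteAdeleRing.ringEquiv_mixedSpace K x.1‖ := by
  change ‖InfiniteAdeleRing.ringEquiv_mixedSpace K ((((posRealIdele K r : (AdeleRing (𝓞 K) K)ˣ) : AdeleRing (𝓞 K) K)).1 * x.1)‖ = _
  rw [posRealIdele_fst, map_mul, ringEquiv_mixedSpace_realToInfiniteAdele, ← Algebra.smul_def, _root_.norm_smul,
    Real.norm_of_nonneg (NNReal.coe_nonneg _)]

/-- `(z(r)·x)_f = x_f`. [folklore] -/
theorem snd_posRealIdele_mul (r : ℝ≥0ˣ) (x : AdeleRing (𝓞 K) K) :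
    (((posRealIdele K r : (AdeleRing (𝓞 K) K)ˣ) : AdeleRing (𝓞 K) K) * x).2 = x.2 := by
  change (((posRealIdele K r : (AdeleRing (𝓞 K) K)ˣ) : AdeleRing (𝓞 K) K)).2 * x.2 = x.2
  rw [posRealIdele_snd, one_mul]

/-! ## §2 The dyadic domination of the archimedean decay -/

omit [NumberField K] in
/-- For `t ≥ 0` there is a least `m` with `t ≤ 2^{m+1}`, and then `(1+t)^{-k} ≤ (2^{mk})⁻¹`. [folklore] -/
theorem exists_nat_le_two_pow_and_rpow_neg_le (k : ℕ) {t : ℝ} (ht : 0 ≤ t) :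
    ∃ m : ℕ, t ≤ 2 ^ (m + 1) ∧ (1 + t) ^ (-(k : ℝ)) ≤ ((2 : ℝ) ^ (m * k))⁻¹ := by
  classical
  have hex : ∃ m : ℕ, t ≤ 2 ^ (m + 1) := by
    obtain ⟨n, hn⟩ := pow_unbounded_of_one_lt t (one_lt_two : (1 : ℝ) < 2)
    exact ⟨n, hn.le.trans (pow_le_pow_right₀ one_le_two (Nat.le_succ n))⟩
  refine ⟨Nat.find hex, Nat.find_spec hex, ?_⟩
  have h1t : 0 < 1 + t := by linarith
  rw [Real.rpow_neg h1t.le, Real.rpow_natCast]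
  apply inv_anti₀ (pow_pos two_pos _)
  rw [pow_mul]
  apply pow_le_pow_left₀ (pow_nonneg zero_le_two _)
  rcases Nat.eq_zero_or_pos (Nat.find hex) with h0 | hpos
  · rw [h0, pow_zero]; linarith
  · have hlt := Nat.find_min hex (Nat.sub_one_lt_of_lt hpos)
    rw [Nat.sub_add_cancel hpos, not_le] at hlt
    linarith

/-! ## §3 The count of one dyadic shell (★ box count at the rescaled idele `z(2^{-(j+1)})·λ`) -/

omit [Field K] [NumberField K] in
/-- `Σ_ξ 𝟙_S(ξ)·c = c·#S` in `ℝ≥0∞` for a finite `S`. [folklore] -/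
theorem tsum_indicator_const_eq_mul_ncard {S : Set K} (hS : S.Finite) (c : ℝ≥0∞) :
    ∑' ξ : K, S.indicator (fun _ => c) ξ = c * (S.ncard : ℝ≥0∞) := by
  classical
  rw [tsum_eq_sum (s := hS.toFinset) (fun ξ hξ => Set.indicator_of_notMem (fun h => hξ (hS.mem_toFinset.2 h)) _),
    Finset.sum_congr rfl (fun ξ hξ => Set.indicator_of_mem (hS.mem_toFinset.1 hξ) (fun _ => c)), Finset.sum_const, nsmul_eq_mul, mul_comm,
    Set.ncard_eq_toFinset_card S hS]

/-- **THE DYADIC SHELL COUNT**: with `c₁` the ★ box-count constant of `C₀ = {‖x_∞‖ ≤ 1, x_f ∈ C_f}`, for `|λ| ≤ 1`, every `Y` and every `j`,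
`#{ξ ∈ K : ‖(λ(ξ − Y))_∞‖ ≤ 2^{j+1}, (λ(ξ − Y))_f ∈ C_f} ≤ c₁·2^{(j+1)d}·|λ|⁻¹` (rescale by `z(2^{-(j+1)})`, `|z(r)λ| = r^d|λ|`).
[cite: Gelbart1975, Lemma 9.13 (proof)] [cite: CasselsFrohlichANT1967, Ch. II §14] -/
theorem finite_and_ncard_shell_le {Cf : Set (FiniteAdeleRing (𝓞 K) K)} {c₁ : ℝ}
    (hcount : ∀ (lam : (AdeleRing (𝓞 K) K)ˣ) (s : AdeleRing (𝓞 K) K),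
      {t : K | (lam : AdeleRing (𝓞 K) K) * algebraMap K (AdeleRing (𝓞 K) K) t + s ∈ {x : AdeleRing (𝓞 K) K | ‖InfiniteAdeleRing.ringEquiv_mixedSpace K x.1‖ ≤ 1 ∧ x.2 ∈ Cf}}.Finite ∧
      (({t : K | (lam : AdeleRing (𝓞 K) K) * algebraMap K (AdeleRing (𝓞 K) K) t + s ∈ {x : AdeleRing (𝓞 K) K | ‖InfiniteAdeleRing.ringEquiv_mixedSpace K x.1‖ ≤ 1 ∧ x.2 ∈ Cf}}.ncard : ℕ) : ℝ) ≤
        c₁ * max 1 ((IdeleClassGroup.ideleNorm K lam : ℝ)⁻¹))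
    (l : (AdeleRing (𝓞 K) K)ˣ) (hl : IdeleClassGroup.ideleNorm K l ≤ 1) (Y : AdeleRing (𝓞 K) K) (j : ℕ) :
    {ξ : K | ‖InfiniteAdeleRing.ringEquiv_mixedSpace K ((l : AdeleRing (𝓞 K) K) * (algebraMap K (AdeleRing (𝓞 K) K) ξ - Y)).1‖ ≤ 2 ^ (j + 1) ∧ ((l : AdeleRing (𝓞 K) K) * (algebraMap K (AdeleRing (𝓞 K) K) ξ - Y)).2 ∈ Cf}.Finite ∧
    (({ξ : K | ‖InfiniteAdeleRing.ringEquiv_mixedSpace K ((l : AdeleRing (𝓞 K) K) * (algebraMap K (AdeleRing (𝓞 K) K) ξ - Y)).1‖ ≤ 2 ^ (j + 1) ∧ ((l : AdeleRing (𝓞 K) K) * (algebraMap K (AdeleRing (𝓞 K) K) ξ - Y)).2 ∈ Cf}.ncard : ℕ) : ℝ) ≤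
      c₁ * 2 ^ ((j + 1) * finrank ℚ K) * (((IdeleClassGroup.ideleNorm K l : ℝ≥0) : ℝ))⁻¹ := by
  -- the rescaling idele `z_j = z(2^{-(j+1)})`
  set rj : ℝ≥0ˣ := Units.mk0 (((2 : ℝ≥0) ^ (j + 1))⁻¹) (inv_ne_zero (pow_ne_zero _ two_ne_zero)) with hrj
  have hrj_coe : ((rj : ℝ≥0) : ℝ) = ((2 : ℝ) ^ (j + 1))⁻¹ := by rw [hrj, Units.val_mk0, NNReal.coe_inv, NNReal.coe_pow, NNReal.coe_ofNat]
  obtain ⟨hfin, hle⟩ := hcount (posRealIdele K rj * l) (-((((posRealIdele K rj * l : (AdeleRing (𝓞 K) K)ˣ)) : AdeleRing (𝓞 K) K) * Y))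
  -- the shell is the rescaled box
  have hset : {ξ : K | ‖InfiniteAdeleRing.ringEquiv_mixedSpace K ((l : AdeleRing (𝓞 K) K) * (algebraMap K (AdeleRing (𝓞 K) K) ξ - Y)).1‖ ≤ 2 ^ (j + 1) ∧ ((l : AdeleRing (𝓞 K) K) * (algebraMap K (AdeleRing (𝓞 K) K) ξ - Y)).2 ∈ Cf} =
      {t : K | ((posRealIdele K rj * l : (AdeleRing (𝓞 K) K)ˣ) : AdeleRing (𝓞 K) K) * algebraMap K (AdeleRing (𝓞 K) K) t + -((((posRealIdele K rj * l : (AdeleRing (𝓞 K) K)ˣ)) : AdeleRing (𝓞 K) K) * Y) ∈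
        {x : AdeleRing (𝓞 K) K | ‖InfiniteAdeleRing.ringEquiv_mixedSpace K x.1‖ ≤ 1 ∧ x.2 ∈ Cf}} := by
    ext ξ
    have e : ((posRealIdele K rj * l : (AdeleRing (𝓞 K) K)ˣ) : AdeleRing (𝓞 K) K) * algebraMap K (AdeleRing (𝓞 K) K) ξ + -((((posRealIdele K rj * l : (AdeleRing (𝓞 K) K)ˣ)) : AdeleRing (𝓞 K) K) * Y) =
        ((posRealIdele K rj : (AdeleRing (𝓞 K) K)ˣ) : AdeleRing (𝓞 K) K) * ((l : AdeleRing (𝓞 K) K) * (algebraMap K (AdeleRing (𝓞 K) K) ξ - Y)) := by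
      rw [Units.val_mul]; ring
    simp only [Set.mem_setOf_eq, e, norm_fst_posRealIdele_mul, snd_posRealIdele_mul, hrj_coe]
    rw [inv_mul_le_iff₀ (pow_pos two_pos _), mul_one]
  rw [hset]
  refine ⟨hfin, hle.trans ?_⟩
  -- `|z_j λ| = 2^{-(j+1)d}|λ|`, so `max 1 |z_j λ|⁻¹ = 2^{(j+1)d}|λ|⁻¹` as `|λ| ≤ 1`
  have hl0 : 0 < ((IdeleClassGroup.ideleNorm K l : ℝ≥0) : ℝ) := NNReal.coe_pos.2 (pos_iff_ne_zero.2 (ideleNorm_ne_zero l))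
  have hnorm : ((IdeleClassGroup.ideleNorm K (posRealIdele K rj * l) : ℝ≥0) : ℝ) =
      ((2 : ℝ) ^ ((j + 1) * finrank ℚ K))⁻¹ * ((IdeleClassGroup.ideleNorm K l : ℝ≥0) : ℝ) := by
    rw [map_mul, ideleNorm_posRealIdele_holds K rj, NNReal.coe_mul, NNReal.coe_pow, hrj_coe, inv_pow, ← pow_mul]
  have hmax : max 1 (((IdeleClassGroup.ideleNorm K (posRealIdele K rj * l) : ℝ≥0) : ℝ))⁻¹ =
      (2 : ℝ) ^ ((j + 1) * finrank ℚ K) * (((IdeleClassGroup.ideleNorm K l : ℝ≥0) : ℝ))⁻¹ := by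
    rw [hnorm, mul_inv, inv_inv]
    refine max_eq_right ?_
    have h1 : (1 : ℝ) ≤ (2 : ℝ) ^ ((j + 1) * finrank ℚ K) := one_le_pow₀ one_le_two
    have h2 : (1 : ℝ) ≤ (((IdeleClassGroup.ideleNorm K l : ℝ≥0) : ℝ))⁻¹ := one_le_inv_iff₀.2 ⟨hl0, by exact_mod_cast hl⟩
    nlinarith
  rw [hmax, mul_assoc]

/-! ## §4 The lattice count -/

/-- **THE `K`-LATTICE COUNT OF A DECAYING FUNCTION UNDER A CONTRACTING DILATION, UNIFORM IN THE SHIFT.**  For `d = [K:ℚ] < k`, `M ≥ 0` and a compact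
`C_f ⊆ 𝔸_K^∞` there is `B ≥ 0` such that for every `Ψ : 𝔸_K → ℂ` with `|Ψ(x)| ≤ M(1+‖x_∞‖)^{-k}` vanishing unless `x_f ∈ C_f` (the decay class of ★ p857643),
every idele `λ` with `|λ| ≤ 1` and EVERY `Y ∈ 𝔸_K`:  `Σ_{ξ ∈ K} |Ψ(λ(ξ − Y))|` converges and is `≤ B·|λ|⁻¹`.
[cite: Gelbart1975, Lemma 9.13 (proof)] [cite: Rogawski1990, §7.2 (p. 95)] [cite: CasselsFrohlichANT1967, Ch. II §14] -/
theorem exists_forall_tsum_norm_dilate_sub_le {k : ℕ} (hk : finrank ℚ K < k) {M : ℝ} (hM0 : 0 ≤ M)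
    {Cf : Set (FiniteAdeleRing (𝓞 K) K)} (hCfc : IsCompact Cf) :
    ∃ B : ℝ, 0 ≤ B ∧ ∀ Ψ : AdeleRing (𝓞 K) K → ℂ,
      (∀ x, ‖Ψ x‖ ≤ M * (1 + ‖InfiniteAdeleRing.ringEquiv_mixedSpace K x.1‖) ^ (-(k : ℝ))) → (∀ x, x.2 ∉ Cf → Ψ x = 0) →
      ∀ (l : (AdeleRing (𝓞 K) K)ˣ) (Y : AdeleRing (𝓞 K) K), IdeleClassGroup.ideleNorm K l ≤ 1 →
        Summable (fun ξ : K => ‖Ψ ((l : AdeleRing (𝓞 K) K) * (algebraMap K (AdeleRing (𝓞 K) K) ξ - Y))‖) ∧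
        ∑' ξ : K, ‖Ψ ((l : AdeleRing (𝓞 K) K) * (algebraMap K (AdeleRing (𝓞 K) K) ξ - Y))‖ ≤ B * (((IdeleClassGroup.ideleNorm K l : ℝ≥0) : ℝ))⁻¹ := by
  obtain ⟨c₁, hc₁, hcount⟩ := exists_ncard_mul_algebraMap_add_mem_le K (isCompact_setOf_norm_le_one_and_mem K hCfc)
  -- the geometric series `Σ_j q^{j+1}`, `q = 2^{-(k−d)} < 1`
  set q : ℝ := ((2 : ℝ) ^ (k - finrank ℚ K))⁻¹ with hq
  have hq0 : 0 ≤ q := by positivity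
  have hq1 : q < 1 := by
    rw [hq]
    exact inv_lt_one_of_one_lt₀ (one_lt_pow₀ one_lt_two (Nat.sub_ne_zero_of_lt hk))
  have hw : ∀ j : ℕ, ((2 : ℝ) ^ ((j + 1) * k))⁻¹ * (2 : ℝ) ^ ((j + 1) * finrank ℚ K) = q ^ (j + 1) := by
    intro j
    have hsplit : (j + 1) * k = (k - finrank ℚ K) * (j + 1) + (j + 1) * finrank ℚ K := by
      have hdk : finrank ℚ K ≤ k := hk.le
      zify [hdk]
      ring
    rw [hq, inv_pow, ← pow_mul, hsplit, pow_add, mul_inv, mul_assoc, inv_mul_cancel₀ (pow_ne_zero _ two_ne_zero), mul_one]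
  have hsumq : Summable (fun j : ℕ => q ^ (j + 1)) :=
    ((summable_geometric_of_lt_one hq0 hq1).mul_left q).congr fun j => by ring
  set S : ℝ := ∑' j : ℕ, q ^ (j + 1) with hS
  have hS0 : 0 ≤ S := tsum_nonneg fun j => pow_nonneg hq0 _
  refine ⟨M * 2 ^ k * c₁ * S, by positivity, ?_⟩
  intro Ψ hM hCf l Y hl
  set L : ℝ := ((IdeleClassGroup.ideleNorm K l : ℝ≥0) : ℝ) with hL
  have hL0 : 0 < L := NNReal.coe_pos.2 (pos_iff_ne_zero.2 (ideleNorm_ne_zero l))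
  -- the dyadic shells and their counts
  set T : ℕ → Set K := fun j =>
    {ξ : K | ‖InfiniteAdeleRing.ringEquiv_mixedSpace K ((l : AdeleRing (𝓞 K) K) * (algebraMap K (AdeleRing (𝓞 K) K) ξ - Y)).1‖ ≤ 2 ^ (j + 1) ∧ ((l : AdeleRing (𝓞 K) K) * (algebraMap K (AdeleRing (𝓞 K) K) ξ - Y)).2 ∈ Cf} with hT
  have hTfin : ∀ j, (T j).Finite := fun j => (finite_and_ncard_shell_le K hcount l hl Y j).1
  have hTle : ∀ j, (((T j).ncard : ℕ) : ℝ) ≤ c₁ * 2 ^ ((j + 1) * finrank ℚ K) * L⁻¹ := fun j => (finite_and_ncard_shell_le K hcount l hl Y j).2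
  -- the dyadic weights
  set a : ℕ → ℝ := fun j => M * 2 ^ k * ((2 : ℝ) ^ ((j + 1) * k))⁻¹ with ha
  have ha0 : ∀ j, 0 ≤ a j := fun j => by positivity
  -- (1) pointwise domination
  have hdom : ∀ ξ : K, (‖Ψ ((l : AdeleRing (𝓞 K) K) * (algebraMap K (AdeleRing (𝓞 K) K) ξ - Y))‖ₑ : ℝ≥0∞) ≤
      ∑' j : ℕ, (T j).indicator (fun _ => ENNReal.ofReal (a j)) ξ := by
    intro ξ
    by_cases hxf : ((l : AdeleRing (𝓞 K) K) * (algebraMap K (AdeleRing (𝓞 K) K) ξ - Y)).2 ∈ Cf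
    · obtain ⟨m, hm, hmk⟩ := exists_nat_le_two_pow_and_rpow_neg_le k (norm_nonneg (InfiniteAdeleRing.ringEquiv_mixedSpace K ((l : AdeleRing (𝓞 K) K) * (algebraMap K (AdeleRing (𝓞 K) K) ξ - Y)).1))
      have hξm : ξ ∈ T m := ⟨hm, hxf⟩
      refine le_trans ?_ (ENNReal.le_tsum m)
      rw [Set.indicator_of_mem hξm, ← ofReal_norm]
      refine ENNReal.ofReal_le_ofReal ((hM _).trans ?_)
      have hsplit : (2 : ℝ) ^ k * ((2 : ℝ) ^ ((m + 1) * k))⁻¹ = ((2 : ℝ) ^ (m * k))⁻¹ := by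
        rw [add_mul, one_mul, pow_add, mul_inv, mul_left_comm, mul_inv_cancel₀ (pow_ne_zero _ (two_ne_zero : (2 : ℝ) ≠ 0)), mul_one]
      rw [ha]
      dsimp only
      rw [mul_assoc, hsplit]
      exact mul_le_mul_of_nonneg_left hmk hM0
    · rw [hCf _ hxf, enorm_zero]
      exact bot_le
  -- (2) Tonelli over the shells and the shell count
  have hmain : (∑' ξ : K, (‖Ψ ((l : AdeleRing (𝓞 K) K) * (algebraMap K (AdeleRing (𝓞 K) K) ξ - Y))‖ₑ : ℝ≥0∞)) ≤ ENNReal.ofReal (M * 2 ^ k * c₁ * S * L⁻¹) := by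
    calc (∑' ξ : K, (‖Ψ ((l : AdeleRing (𝓞 K) K) * (algebraMap K (AdeleRing (𝓞 K) K) ξ - Y))‖ₑ : ℝ≥0∞))
        ≤ ∑' ξ : K, ∑' j : ℕ, (T j).indicator (fun _ => ENNReal.ofReal (a j)) ξ := ENNReal.tsum_le_tsum hdom
      _ = ∑' j : ℕ, ∑' ξ : K, (T j).indicator (fun _ => ENNReal.ofReal (a j)) ξ := ENNReal.tsum_comm
      _ = ∑' j : ℕ, ENNReal.ofReal (a j) * ((T j).ncard : ℝ≥0∞) := tsum_congr fun j => tsum_indicator_const_eq_mul_ncard K (hTfin j) _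
      _ ≤ ∑' j : ℕ, ENNReal.ofReal (a j) * ENNReal.ofReal (c₁ * 2 ^ ((j + 1) * finrank ℚ K) * L⁻¹) := by
          refine ENNReal.tsum_le_tsum fun j => mul_le_mul_of_nonneg_left ?_ bot_le
          rw [← ENNReal.ofReal_natCast]
          exact ENNReal.ofReal_le_ofReal (hTle j)
      _ = ∑' j : ℕ, ENNReal.ofReal (M * 2 ^ k * c₁ * L⁻¹ * q ^ (j + 1)) := by
          refine tsum_congr fun j => ?_
          rw [← ENNReal.ofReal_mul (ha0 j), ← hw j, ha]
          congr 1
          ring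
      _ = ENNReal.ofReal (∑' j : ℕ, M * 2 ^ k * c₁ * L⁻¹ * q ^ (j + 1)) :=
          (ENNReal.ofReal_tsum_of_nonneg (fun j => mul_nonneg (by positivity) (pow_nonneg hq0 _)) (hsumq.mul_left _)).symm
      _ = ENNReal.ofReal (M * 2 ^ k * c₁ * S * L⁻¹) := by rw [tsum_mul_left, hS]; ring_nf
  -- (3) back to `ℝ`
  have hne : (∑' ξ : K, (‖Ψ ((l : AdeleRing (𝓞 K) K) * (algebraMap K (AdeleRing (𝓞 K) K) ξ - Y))‖ₑ : ℝ≥0∞)) ≠ ⊤ := ne_top_of_le_ne_top ENNReal.ofReal_ne_top hmain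
  have hsum : Summable (fun ξ : K => ‖Ψ ((l : AdeleRing (𝓞 K) K) * (algebraMap K (AdeleRing (𝓞 K) K) ξ - Y))‖) := by
    have h := NNReal.summable_coe.2 (ENNReal.tsum_coe_ne_top_iff_summable.1 (by simpa only [enorm_eq_nnnorm] using hne))
    simpa only [coe_nnnorm] using h
  refine ⟨hsum, ?_⟩
  have h2 : ENNReal.ofReal (∑' ξ : K, ‖Ψ ((l : AdeleRing (𝓞 K) K) * (algebraMap K (AdeleRing (𝓞 K) K) ξ - Y))‖) ≤ ENNReal.ofReal (M * 2 ^ k * c₁ * S * L⁻¹) := by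
    rw [ENNReal.ofReal_tsum_of_nonneg (fun _ => norm_nonneg _) hsum]
    simp only [ofReal_norm]
    exact hmain
  exact (ENNReal.ofReal_le_ofReal_iff (by positivity)).1 h2

end Summit.HodgeConjecture.HodgeConjecture.Cruxes.H413.K2E1CentreLineLatticeCountU3

end
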